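import Literature.MathematicalPhysics.QuantumFieldTheory.Federbush1986.AbelianEstimatesLe

/-!
# `Federbush1986.LatticeGaugeFunction` — [Federbush1986PhaseCellI] §4 p. 329, (4.3)–(4.4): the lattice gauge function
# `h` on `ℤ⁴` with `A(e) − A^N(e) = h(b) − h(a)`, `h(x) → 0`, `|h(x)| < ce^{−γ|x|}` — PROVED as the lattice lemma «an
# exponentially decaying bond function on `ℤ⁴` with zero plaquette values is the coboundary of an exponentially decaying
# site function»

statement-level skeleton of published theorems with citation tags; proofs where landed; nothing here is a claim about the Yang–Mills mass gap

CITATION HEADER.  P. Federbush, *A phase cell approach to Yang–Mills theory. I. Modes, lattice-continuum duality*, Commun.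
Math. Phys. **107** (1986) 319–329 [Federbush1986PhaseCellI], §4 «The Gauge Transformation, Λ(x)» p. 329 (render
`run/shared/lean/pub/lit-balaban/lit-balaban-r17/renders/fedI/fed1986-cmp107-p011-x2.png`, re-read as an image), verbatim:
*«By (2.13) and (3.13) we have |A^N(e)| < ce^{−γd(e,0)}. (4.1)  Clearly |A(e)| < ce^{−γd(e,0)}. (4.2)  (A(e) is zero almost
everywhere.)  We set up a gauge field h(x) on Z⁴ by A(e) − A^N(e) = h(b) − h(a) (4.3) for e = ab.  Recall since A^N(e) and A(e)
yield the same plaquette variables, they are related by a lattice gauge transformation.  We require h(x) → 0 (x → ∞).  We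
deduce |h(x)| < ce^{−γ|x|}. (4.4)»*  Unit `lit-balaban-p04` gen 6; SKELETON row **F1.Eq4.1-4.6** of
`run/shared/lean/pub/lit-balaban/lit-balaban-r17/SKELETON-r17.md` (fold owner r17); companions `AbelianEstimatesLe` (p252610),
`AbelianEstimatesSect4` ((4.1) = `eq41_of_eq213_of_decay`).

THE MATHEMATICS (the sentence «they are related by a lattice gauge transformation … We require h(x) → 0 … We deduce
(4.4)» made into a lemma).  Let `f : Edge 0 → ℝ` be a level-0 bond function (`f = A − A^N`) with ZERO PLAQUETTE VALUES
(`plaqOfBonds f p = 0`; abelian «yield the same plaquette variables») and `|f(e)| ≤ ce^{−γ|src e|}`, `γ > 0` ((4.1)–(4.2),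
`DecayBound`).  Put `h(x) := −Σ_{n≥0} f(x + ne₀, 0)` (`gaugeFn`: the bond values summed along the `+e₀`-ray from `x`;
absolutely convergent since `|x + ne₀| ≥ n − |x|`).  (i) For every direction `μ`: `h(x + e_μ) − h(x) = Σ_n [f(x+ne₀, 0) −
f(x+ne₀+e_μ, 0)] = Σ_n [f(x+ne₀, μ) − f(x+(n+1)e₀, μ)] = f(x, μ)` — the plaquette relation at `(x + ne₀; 0, μ)` and a
telescoping sum: **(4.3)** (`gaugeFn_bond`).  (ii) DECAY.  For `x₀ ≥ 0` the ray moves away from the origin,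
`|x + ne₀| ≥ max(|x|, n) ≥ (|x| + n)/2`, so `|h(x)| ≤ Σ_n ce^{−γ(|x|+n)/2} = c(1 − e^{−γ/2})⁻¹e^{−γ|x|/2}` (`abs_tsum_ray_le`).
For `x₀ < 0` use the backward ray `P(x) = Σ_{n≥0} f(x − (n+1)e₀, 0)` (`backSum`, same bound) and `h = P − S` with the LINE
SUM `S(x) = Σ_{m∈ℤ} f(x + me₀, 0)` (`lineSum`): `S` is invariant under `x ↦ x + e₀` (re-indexing) and under `x ↦ x + e_μ`
(the two half-line sums change by `∓f(x,μ)`), hence CONSTANT on `ℤ⁴` (`lineSum_const`), and `S(Me₁) → 0`, so `S ≡ 0`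
(`lineSum_eq_zero`) — this is where «h(x) → 0» fixes the free constant and where a second lattice direction is used.  Hence
**(4.4)** as `|h(x)| ≤ c(1 − e^{−γ/2})⁻¹e^{−(γ/2)|x|}` (`abs_gaugeFn_le`; print's `c, γ` are generic — the halving of `γ`
pays for `max(|x|, n)` in place of `|x| + n`).  (iii) UNIQUENESS («We require h(x) → 0»): a site function with coboundary
`f` tending to `0` along the `+e₀`-rays IS `h` (`gaugeFn_unique`).

WHAT THIS MODULE PROVIDES.  Defs `gaugeFn`, `backSum`, `lineSum` (bodies) and the predicate `DecayBound f c γ`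
(= (4.1)–(4.2), a hypothesis, not a claim); §1 lattice-point norms (`Edge.src_base_eq`, `norm_src_eq_sqrt`,
`abs_cast_le_norm_src`, `norm_src_mono`, `norm_shift_ge`, `norm_shift_away`); §2 `summable_ray`, `abs_tsum_ray_le`,
`tsum_sub_succ`; §3 **`gaugeFn_bond`** ((4.3)), `lineSum_shift0`, `lineSum_shift`, `lineSum_const`, `lineSum_eq_zero`,
**`abs_gaugeFn_le`** ((4.4)), **`exists_gaugeFn`**, `gaugeFn_unique`; §4 the F1-facing corollary `exists_gaugeFn_of_plaq_eq`
(data `a` and bond assignments `b` with the same plaquette values).  No new unproved fact; axioms standard.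
-/

namespace Literature.MathematicalPhysics.QuantumFieldTheory.Federbush1986

open Filter Set
open scoped BigOperators

noncomputable section

namespace LatticeGauge

/-! ## §1 Lattice points of `ℒ⁰ = ℤ⁴` and their norms -/

/-- At level 0 the base vertex of `(x, μ)` is the integer point `x` itself (`ℓ_0 = 1`). [cite: Federbush1986PhaseCellI, §1
p. 321, §4 p. 329] -/
theorem Edge.src_base_eq (x : Fin 4 → ℤ) (μ : Fin 4) : (⟨x, μ⟩ : Edge 0).src = mkPt fun k => (x k : ℝ) := by
  unfold Edge.src; congr 1; funext k; simp [latLen]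

/-- `|src (x, μ)| = (Σ_k x_k²)^{1/2}` («|x|», `x ∈ Z⁴`). [cite: Federbush1986PhaseCellI, §4 (4.4) p. 329] -/
theorem norm_src_eq_sqrt (x : Fin 4 → ℤ) (μ : Fin 4) :
    ‖(⟨x, μ⟩ : Edge 0).src‖ = Real.sqrt (∑ k, (x k : ℝ) ^ 2) := by
  rw [Edge.src_base_eq, EuclideanSpace.norm_eq]
  simp [mkPt, sq_abs]

/-- Each coordinate is bounded by the norm: `|x_k| ≤ |x|`. [cite: Federbush1986PhaseCellI, §4 p. 329] -/
theorem abs_cast_le_norm_src (x : Fin 4 → ℤ) (μ k : Fin 4) : |(x k : ℝ)| ≤ ‖(⟨x, μ⟩ : Edge 0).src‖ := by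
  rw [norm_src_eq_sqrt]
  exact Real.abs_le_sqrt (Finset.single_le_sum (f := fun k => (x k : ℝ) ^ 2) (fun i _ => sq_nonneg _) (by simp))

/-- Coordinatewise domination of absolute values gives domination of norms. [cite: Federbush1986PhaseCellI, §4 p. 329] -/
theorem norm_src_mono {x y : Fin 4 → ℤ} (h : ∀ k, |(x k : ℝ)| ≤ |(y k : ℝ)|) (μ ν : Fin 4) :
    ‖(⟨x, μ⟩ : Edge 0).src‖ ≤ ‖(⟨y, ν⟩ : Edge 0).src‖ := by
  rw [norm_src_eq_sqrt, norm_src_eq_sqrt]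
  exact Real.sqrt_le_sqrt (Finset.sum_le_sum fun k _ => sq_le_sq.2 (h k))

/-- Along the `e₀`-line, `|x + me₀| ≥ |m| − |x|`. [cite: Federbush1986PhaseCellI, §4 p. 329] -/
theorem norm_shift_ge (x : Fin 4 → ℤ) (m : ℤ) (μ : Fin 4) :
    |(m : ℝ)| - ‖(⟨x, 0⟩ : Edge 0).src‖ ≤ ‖(⟨x + Pi.single 0 m, μ⟩ : Edge 0).src‖ := by
  have h1 := abs_cast_le_norm_src (x + Pi.single 0 m) μ 0
  have h2 := abs_cast_le_norm_src x 0 0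
  simp only [Pi.add_apply, Pi.single_eq_same, Int.cast_add] at h1
  have h3 : |(m : ℝ)| ≤ |(x 0 : ℝ) + (m : ℝ)| + |(x 0 : ℝ)| := by
    have := abs_add_le ((x 0 : ℝ) + m) (-(x 0 : ℝ))
    rwa [abs_neg, add_neg_cancel_comm] at this
  linarith

/-- Moving AWAY from the origin along `e₀` (`x₀·m ≥ 0`): `|x + me₀| ≥ |x|` and `|x + me₀| ≥ |m|`.
[cite: Federbush1986PhaseCellI, §4 p. 329] -/
theorem norm_shift_away {x : Fin 4 → ℤ} {m : ℤ} (hxm : 0 ≤ x 0 * m) (μ : Fin 4) :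
    ‖(⟨x, 0⟩ : Edge 0).src‖ ≤ ‖(⟨x + Pi.single 0 m, μ⟩ : Edge 0).src‖ ∧
      |(m : ℝ)| ≤ ‖(⟨x + Pi.single 0 m, μ⟩ : Edge 0).src‖ := by
  have hxm' : (0 : ℝ) ≤ (x 0 : ℝ) * (m : ℝ) := by exact_mod_cast hxm
  have habs : |(x 0 : ℝ) + m| = |(x 0 : ℝ)| + |(m : ℝ)| := (abs_add_eq_add_abs_iff _ _).2 (mul_nonneg_iff.1 hxm')
  have hco : ∀ k, |(x k : ℝ)| ≤ |((x + Pi.single 0 m : Fin 4 → ℤ) k : ℝ)| := by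
    intro k
    by_cases hk : k = 0
    · subst hk
      rw [Pi.add_apply, Pi.single_eq_same, Int.cast_add, habs]
      exact le_add_of_nonneg_right (abs_nonneg _)
    · rw [Pi.add_apply, Pi.single_eq_of_ne hk, add_zero]
  refine ⟨norm_src_mono hco 0 μ, ?_⟩
  have h1 := abs_cast_le_norm_src (x + Pi.single 0 m) μ 0
  rw [Pi.add_apply, Pi.single_eq_same, Int.cast_add, habs] at h1
  linarith [abs_nonneg (x 0 : ℝ)]

/-- Composition of two shifts along `e₀`. [cite: Federbush1986PhaseCellI, §4 p. 329] -/
theorem shift_shift (x : Fin 4 → ℤ) (a b : ℤ) :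
    x + Pi.single 0 a + Pi.single 0 b = x + Pi.single 0 (a + b) := by
  rw [add_assoc, ← Pi.single_add]

/-! ## §2 The decay bound, ray sums: summability, the geometric tail bound, telescoping -/

/-- The decay hypothesis (4.1)–(4.2) for a level-0 bond function: `|f(e)| ≤ ce^{−γd(e,0)}`, `d(e,0) = |src e|`.
[cite: Federbush1986PhaseCellI, (4.1)–(4.2) p. 329] -/
def DecayBound (f : Edge 0 → ℝ) (c γ : ℝ) : Prop := ∀ e : Edge 0, |f e| ≤ c * Real.exp (-γ * ‖e.src‖)

/-- The constant of a decay bound is non-negative. [cite: Federbush1986PhaseCellI, (4.1)–(4.2) p. 329] -/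
theorem DecayBound.c_nonneg {f : Edge 0 → ℝ} {c γ : ℝ} (hf : DecayBound f c γ) : 0 ≤ c := by
  by_contra hc; rw [not_le] at hc
  have h1 := (abs_nonneg _).trans (hf ⟨0, 0⟩)
  have h2 := mul_neg_of_neg_of_pos hc (Real.exp_pos (-γ * ‖(⟨0, 0⟩ : Edge 0).src‖))
  linarith

/-- **Summability along an `e₀`-ray.**  For indices `g n` with `|g n| ≥ n` (the forward ray `g n = n`, the backward rays
`g n = −n`, `−(n+1)`), `Σ_n f(x + g(n)e₀, μ)` converges absolutely: `|x + g(n)e₀| ≥ n − |x|` and the bound is geometric.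
[cite: Federbush1986PhaseCellI, §4 (4.3)–(4.4) p. 329] -/
theorem summable_ray {f : Edge 0 → ℝ} {c γ : ℝ} (hγ : 0 < γ) (hf : DecayBound f c γ) (x : Fin 4 → ℤ) (μ : Fin 4)
    {g : ℕ → ℤ} (hg : ∀ n : ℕ, (n : ℝ) ≤ |((g n : ℤ) : ℝ)|) : Summable fun n => f ⟨x + Pi.single 0 (g n), μ⟩ := by
  have hc : 0 ≤ c := hf.c_nonneg
  have hr1 : Real.exp (-γ) < 1 := Real.exp_lt_one_iff.2 (by linarith)
  refine Summable.of_norm_bounded (g := fun n => c * Real.exp (γ * ‖(⟨x, 0⟩ : Edge 0).src‖) * Real.exp (-γ) ^ n)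
    ((summable_geometric_of_lt_one (Real.exp_pos _).le hr1).mul_left _) fun n => ?_
  rw [Real.norm_eq_abs]
  refine (hf _).trans ?_
  have h4 : (n : ℝ) - ‖(⟨x, 0⟩ : Edge 0).src‖ ≤ ‖(⟨x + Pi.single 0 (g n), μ⟩ : Edge 0).src‖ := by
    linarith [hg n, norm_shift_ge x (g n) μ]
  rw [mul_assoc, ← Real.exp_nat_mul, ← Real.exp_add]
  refine mul_le_mul_of_nonneg_left (Real.exp_le_exp.2 ?_) hc
  linarith [mul_le_mul_of_nonneg_left h4 hγ.le]

/-- Telescoping of a summable sequence: `Σ_n (v_n − v_{n+1}) = v_0`. [cite: Federbush1986PhaseCellI, §4 (4.3) p. 329] -/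
theorem tsum_sub_succ {v : ℕ → ℝ} (hv : Summable v) : ∑' n, (v n - v (n + 1)) = v 0 := by
  rw [hv.tsum_sub ((summable_nat_add_iff 1).2 hv), hv.tsum_eq_zero_add]
  ring

/-- **The geometric tail bound.**  Along a ray moving AWAY from the origin (`x₀·g(n) ≥ 0`, `|g n| ≥ n`) one has
`|x + g(n)e₀| ≥ max(|x|, n) ≥ (|x| + n)/2`, whence `|Σ_n f(x + g(n)e₀, μ)| ≤ c(1 − e^{−γ/2})⁻¹ e^{−(γ/2)|x|}`.
[cite: Federbush1986PhaseCellI, §4 (4.4) p. 329] -/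
theorem abs_tsum_ray_le {f : Edge 0 → ℝ} {c γ : ℝ} (hγ : 0 < γ) (hf : DecayBound f c γ) {x : Fin 4 → ℤ} (μ : Fin 4)
    {g : ℕ → ℤ} (hg : ∀ n : ℕ, (n : ℝ) ≤ |((g n : ℤ) : ℝ)|) (hxg : ∀ n : ℕ, 0 ≤ x 0 * g n) :
    |∑' n, f ⟨x + Pi.single 0 (g n), μ⟩|
      ≤ c * (1 - Real.exp (-(γ / 2)))⁻¹ * Real.exp (-(γ / 2) * ‖(⟨x, 0⟩ : Edge 0).src‖) := by
  have hc : 0 ≤ c := hf.c_nonneg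
  have hr0 : 0 ≤ Real.exp (-(γ / 2)) := (Real.exp_pos _).le
  have hr1 : Real.exp (-(γ / 2)) < 1 := Real.exp_lt_one_iff.2 (by linarith)
  have hG := (hasSum_geometric_of_lt_one hr0 hr1).mul_left (c * Real.exp (-(γ / 2) * ‖(⟨x, 0⟩ : Edge 0).src‖))
  have hpt : ∀ n : ℕ, ‖f ⟨x + Pi.single 0 (g n), μ⟩‖
      ≤ c * Real.exp (-(γ / 2) * ‖(⟨x, 0⟩ : Edge 0).src‖) * Real.exp (-(γ / 2)) ^ n := by
    intro n
    rw [Real.norm_eq_abs]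
    refine (hf _).trans ?_
    obtain ⟨hNx, hNm⟩ := norm_shift_away (hxg n) μ
    have hNn : (n : ℝ) ≤ ‖(⟨x + Pi.single 0 (g n), μ⟩ : Edge 0).src‖ := (hg n).trans hNm
    rw [mul_assoc, ← Real.exp_nat_mul, ← Real.exp_add]
    refine mul_le_mul_of_nonneg_left (Real.exp_le_exp.2 ?_) hc
    nlinarith
  refine (tsum_of_norm_bounded hG hpt).trans_eq ?_
  ring

/-! ## §3 The gauge function (4.3), the line sum, and the decay (4.4) -/

/-- **(4.3), the gauge function** `h(x) = −Σ_{n≥0} f(x + ne₀, 0)` (the bond values summed along the ray from `x` in the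
`+e₀` direction; print: «We set up a gauge field h(x) on Z⁴ by A(e) − A^N(e) = h(b) − h(a) … We require h(x) → 0»).
[cite: Federbush1986PhaseCellI, (4.3) p. 329] -/
def gaugeFn (f : Edge 0 → ℝ) (x : Fin 4 → ℤ) : ℝ := -∑' n : ℕ, f ⟨x + Pi.single 0 (n : ℤ), 0⟩

/-- The backward ray sum `P(x) = Σ_{n≥0} f(x − (n+1)e₀, 0)`. [cite: Federbush1986PhaseCellI, (4.3)–(4.4) p. 329] -/
def backSum (f : Edge 0 → ℝ) (x : Fin 4 → ℤ) : ℝ := ∑' n : ℕ, f ⟨x + Pi.single 0 (-((n : ℤ) + 1)), 0⟩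

/-- The line sum `S(x) = Σ_{m∈ℤ} f(x + me₀, 0)` (forward ray sum plus backward ray sum). [cite: Federbush1986PhaseCellI,
(4.3)–(4.4) p. 329] -/
def lineSum (f : Edge 0 → ℝ) (x : Fin 4 → ℤ) : ℝ := (∑' n : ℕ, f ⟨x + Pi.single 0 (n : ℤ), 0⟩) + backSum f x

/-- `h = P − S`. [cite: Federbush1986PhaseCellI, (4.3) p. 329] -/
theorem gaugeFn_eq_backSum_sub_lineSum (f : Edge 0 → ℝ) (x : Fin 4 → ℤ) :
    gaugeFn f x = backSum f x - lineSum f x := by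
  unfold gaugeFn lineSum; ring

/-- The plaquette relation at `(y; 0, μ)`: `f(y,0) − f(y+e_μ,0) = f(y,μ) − f(y+e₀,μ)`. [cite: Federbush1986PhaseCellI, §4
p. 329 («yield the same plaquette variables»), (1.4) p. 322] -/
theorem plaq_rel {f : Edge 0 → ℝ} (hcurl : ∀ p : Plaq 0, plaqOfBonds f p = 0) (y : Fin 4 → ℤ) (μ : Fin 4) :
    f ⟨y, 0⟩ - f ⟨y + Pi.single μ 1, 0⟩ = f ⟨y, μ⟩ - f ⟨y + Pi.single 0 1, μ⟩ := by
  have h := hcurl ⟨y, 0, μ⟩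
  unfold plaqOfBonds at h; dsimp only at h; linarith

/-- `n ≤ |n|`, `n ≤ |−n|`, `n ≤ |−(n+1)|` for the three rays used. [folklore] -/
private theorem ray_indices (n : ℕ) :
    ((n : ℝ) ≤ |(((n : ℤ) : ℤ) : ℝ)|) ∧ ((n : ℝ) ≤ |((-(n : ℤ) : ℤ) : ℝ)|) ∧
      ((n : ℝ) ≤ |((-((n : ℤ) + 1) : ℤ) : ℝ)|) := by
  refine ⟨by simp, by simp, ?_⟩
  rw [Int.cast_neg, abs_neg]; push_cast; rw [abs_of_nonneg (by positivity)]; linarith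

/-- **(4.3)** for every bond: `h(x + e_μ) − h(x) = f(x, μ)`, i.e. `f = d₀h` («A(e) − A^N(e) = h(b) − h(a) for e = ab»), from
the zero plaquette values by telescoping along the `e₀`-rays. [cite: Federbush1986PhaseCellI, (4.3) p. 329] -/
theorem gaugeFn_bond {f : Edge 0 → ℝ} {c γ : ℝ} (hγ : 0 < γ) (hf : DecayBound f c γ)
    (hcurl : ∀ p : Plaq 0, plaqOfBonds f p = 0) (x : Fin 4 → ℤ) (μ : Fin 4) :
    gaugeFn f (x + Pi.single μ 1) - gaugeFn f x = f ⟨x, μ⟩ := by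
  have hgn : ∀ n : ℕ, (n : ℝ) ≤ |(((n : ℤ) : ℤ) : ℝ)| := fun n => (ray_indices n).1
  have hS0 := summable_ray hγ hf x 0 hgn
  have hS1 := summable_ray hγ hf (x + Pi.single μ 1) 0 hgn
  have hSμ := summable_ray hγ hf x μ hgn
  unfold gaugeFn
  rw [neg_sub_neg, ← hS0.tsum_sub hS1]
  have hterm : ∀ n : ℕ, f ⟨x + Pi.single 0 (n : ℤ), 0⟩ - f ⟨x + Pi.single μ 1 + Pi.single 0 (n : ℤ), 0⟩
      = f ⟨x + Pi.single 0 (n : ℤ), μ⟩ - f ⟨x + Pi.single 0 ((n : ℤ) + 1), μ⟩ := by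
    intro n
    rw [add_right_comm x, plaq_rel hcurl, shift_shift]
  simp_rw [hterm]
  have h := tsum_sub_succ hSμ
  simp only [Nat.cast_succ, Nat.cast_zero, Pi.single_zero, add_zero] at h
  exact h

/-- The line sum is invariant under the shift `x ↦ x + e₀` (re-indexing). [cite: Federbush1986PhaseCellI, (4.3)–(4.4) p. 329] -/
theorem lineSum_shift0 {f : Edge 0 → ℝ} {c γ : ℝ} (hγ : 0 < γ) (hf : DecayBound f c γ) (x : Fin 4 → ℤ) :
    lineSum f (x + Pi.single 0 1) = lineSum f x := by
  have hS0 := summable_ray hγ hf x 0 fun n => (ray_indices n).1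
  have hSm := summable_ray hγ hf x 0 fun n => (ray_indices n).2.1
  unfold lineSum backSum
  have e1 : ∀ n : ℕ, f ⟨x + Pi.single 0 1 + Pi.single 0 (n : ℤ), 0⟩ = f ⟨x + Pi.single 0 (((n + 1 : ℕ) : ℤ)), 0⟩ := by
    intro n; rw [shift_shift, Nat.cast_succ, add_comm (1 : ℤ) (n : ℤ)]
  have e2 : ∀ n : ℕ, f ⟨x + Pi.single 0 1 + Pi.single 0 (-((n : ℤ) + 1)), 0⟩ = f ⟨x + Pi.single 0 (-(n : ℤ)), 0⟩ := by
    intro n; rw [shift_shift]; ring_nf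
  have e3 : ∀ n : ℕ, f ⟨x + Pi.single 0 (-((n : ℤ) + 1)), 0⟩ = f ⟨x + Pi.single 0 (-(((n + 1 : ℕ) : ℤ))), 0⟩ := by
    intro n; rw [Nat.cast_succ]
  simp_rw [e1, e2, e3]
  rw [hS0.tsum_eq_zero_add, hSm.tsum_eq_zero_add]
  simp only [Nat.cast_zero, neg_zero, Pi.single_zero, add_zero]
  ring

/-- The line sum is invariant under every unit shift `x ↦ x + e_μ`: by the plaquette relation the forward half changes by
`−f(x,μ)` ((4.3)) and the backward half by `+f(x,μ)`. [cite: Federbush1986PhaseCellI, (4.3)–(4.4) p. 329] -/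
theorem lineSum_shift {f : Edge 0 → ℝ} {c γ : ℝ} (hγ : 0 < γ) (hf : DecayBound f c γ)
    (hcurl : ∀ p : Plaq 0, plaqOfBonds f p = 0) (x : Fin 4 → ℤ) (μ : Fin 4) :
    lineSum f (x + Pi.single μ 1) = lineSum f x := by
  have hgb : ∀ n : ℕ, (n : ℝ) ≤ |((-((n : ℤ) + 1) : ℤ) : ℝ)| := fun n => (ray_indices n).2.2
  have hB0 := summable_ray hγ hf x 0 hgb
  have hB1 := summable_ray hγ hf (x + Pi.single μ 1) 0 hgb
  have hBμ := summable_ray hγ hf x μ fun n => (ray_indices n).2.1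
  -- forward halves: (4.3)
  have hfwd : (∑' n : ℕ, f ⟨x + Pi.single μ 1 + Pi.single 0 (n : ℤ), 0⟩)
      = (∑' n : ℕ, f ⟨x + Pi.single 0 (n : ℤ), 0⟩) - f ⟨x, μ⟩ := by
    have h := gaugeFn_bond hγ hf hcurl x μ
    unfold gaugeFn at h
    linarith
  -- backward halves: telescoping in the other direction
  have hbwd : backSum f (x + Pi.single μ 1) = backSum f x + f ⟨x, μ⟩ := by
    unfold backSum
    rw [← sub_eq_iff_eq_add', ← hB1.tsum_sub hB0]
    have hterm : ∀ n : ℕ,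
        f ⟨x + Pi.single μ 1 + Pi.single 0 (-((n : ℤ) + 1)), 0⟩ - f ⟨x + Pi.single 0 (-((n : ℤ) + 1)), 0⟩
          = f ⟨x + Pi.single 0 (-(n : ℤ)), μ⟩ - f ⟨x + Pi.single 0 (-(((n + 1 : ℕ) : ℤ))), μ⟩ := by
      intro n
      have h := plaq_rel hcurl (x + Pi.single 0 (-((n : ℤ) + 1))) μ
      rw [shift_shift, add_right_comm x] at h
      rw [show -((n : ℤ) + 1) + 1 = -(n : ℤ) by ring] at h
      rw [Nat.cast_succ]; linarith
    simp_rw [hterm]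
    have h2 := tsum_sub_succ hBμ
    simp only [Nat.cast_zero, neg_zero, Pi.single_zero, add_zero] at h2
    exact h2
  unfold lineSum; rw [hfwd, hbwd]; ring

/-- The line sum is invariant under all lattice translations, hence constant. [cite: Federbush1986PhaseCellI, (4.3)–(4.4)
p. 329] -/
theorem lineSum_const {f : Edge 0 → ℝ} {c γ : ℝ} (hγ : 0 < γ) (hf : DecayBound f c γ)
    (hcurl : ∀ p : Plaq 0, plaqOfBonds f p = 0) (x : Fin 4 → ℤ) : lineSum f x = lineSum f 0 := by
  -- invariance under `+ m e_μ`, all `m : ℤ`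
  have hm : ∀ (y : Fin 4 → ℤ) (μ : Fin 4) (m : ℤ), lineSum f (y + Pi.single μ m) = lineSum f y := by
    intro y μ m
    induction m using Int.induction_on with
    | zero => simp
    | succ m ih =>
        rw [Pi.single_add, ← add_assoc, lineSum_shift hγ hf hcurl, ih]
    | pred m ih =>
        have e : y + Pi.single μ (-(m : ℤ)) = y + Pi.single μ (-(m : ℤ) - 1) + Pi.single μ 1 := by
          rw [add_assoc, ← Pi.single_add]; ring_nf
        rw [← ih, e, lineSum_shift hγ hf hcurl]
  have hx : x = 0 + Pi.single 0 (x 0) + Pi.single 1 (x 1) + Pi.single 2 (x 2) + Pi.single 3 (x 3) := by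
    funext k
    fin_cases k <;> simp
  rw [hx, hm, hm, hm, hm]

/-- The line sum vanishes: it is constant and `S(Me₁) → 0` as `M → ∞` (both half-rays from `Me₁` move away from the origin,
`|Me₁ + me₀| ≥ max(M, |m|)`). [cite: Federbush1986PhaseCellI, (4.4) p. 329 («We require h(x) → 0»)] -/
theorem lineSum_eq_zero {f : Edge 0 → ℝ} {c γ : ℝ} (hγ : 0 < γ) (hf : DecayBound f c γ)
    (hcurl : ∀ p : Plaq 0, plaqOfBonds f p = 0) (x : Fin 4 → ℤ) : lineSum f x = 0 := by
  rw [lineSum_const hγ hf hcurl]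
  have hr0 : 0 ≤ Real.exp (-(γ / 2)) := (Real.exp_pos _).le
  have hr1 : Real.exp (-(γ / 2)) < 1 := Real.exp_lt_one_iff.2 (by linarith)
  -- `|S(Me₁)| ≤ 2K r^M`
  have hbound : ∀ M : ℕ,
      |lineSum f 0| ≤ 2 * (c * (1 - Real.exp (-(γ / 2)))⁻¹) * Real.exp (-(γ / 2)) ^ M := by
    intro M
    set y : Fin 4 → ℤ := Pi.single 1 (M : ℤ) with hy
    have hy0 : y 0 = 0 := by rw [hy]; simp
    have hNy : ‖(⟨y, 0⟩ : Edge 0).src‖ = M := by rw [norm_src_eq_sqrt, hy]; simp [Fin.sum_univ_four]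
    rw [← lineSum_const hγ hf hcurl y]
    have h1 := abs_tsum_ray_le hγ hf (x := y) 0 (fun n => (ray_indices n).1) (fun n => by simp [hy0])
    have h2 := abs_tsum_ray_le hγ hf (x := y) 0 (fun n => (ray_indices n).2.2) (fun n => by simp [hy0])
    rw [hNy] at h1 h2
    have er : Real.exp (-(γ / 2) * (M : ℝ)) = Real.exp (-(γ / 2)) ^ M := by rw [← Real.exp_nat_mul]; ring_nf
    rw [er] at h1 h2
    unfold lineSum backSum
    exact (abs_add_le _ _).trans ((add_le_add h1 h2).trans_eq (by ring))
  have hlim : Tendsto (fun M : ℕ => 2 * (c * (1 - Real.exp (-(γ / 2)))⁻¹) * Real.exp (-(γ / 2)) ^ M) atTop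
      (nhds 0) := by
    have := (tendsto_pow_atTop_nhds_zero_of_lt_one hr0 hr1).const_mul (2 * (c * (1 - Real.exp (-(γ / 2)))⁻¹))
    simpa using this
  exact abs_nonpos_iff.1 (ge_of_tendsto' hlim hbound)

/-- **(4.4)** «We deduce |h(x)| < ce^{−γ|x|}» — here `|h(x)| ≤ c(1 − e^{−γ/2})⁻¹e^{−(γ/2)|x|}` (print's constants generic):
the forward ray for `x₀ ≥ 0`, the backward ray and `S ≡ 0` for `x₀ < 0`. [cite: Federbush1986PhaseCellI, (4.4) p. 329] -/
theorem abs_gaugeFn_le {f : Edge 0 → ℝ} {c γ : ℝ} (hγ : 0 < γ) (hf : DecayBound f c γ)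
    (hcurl : ∀ p : Plaq 0, plaqOfBonds f p = 0) (x : Fin 4 → ℤ) :
    |gaugeFn f x| ≤ c * (1 - Real.exp (-(γ / 2)))⁻¹ * Real.exp (-(γ / 2) * ‖(⟨x, 0⟩ : Edge 0).src‖) := by
  rcases le_or_gt 0 (x 0) with hx | hx
  · unfold gaugeFn; rw [abs_neg]
    exact abs_tsum_ray_le hγ hf 0 (fun n => (ray_indices n).1) (fun n => mul_nonneg hx (Int.natCast_nonneg n))
  · rw [gaugeFn_eq_backSum_sub_lineSum, lineSum_eq_zero hγ hf hcurl, sub_zero]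
    unfold backSum
    refine abs_tsum_ray_le hγ hf 0 (fun n => (ray_indices n).2.2) (fun n => ?_)
    have : (0 : ℤ) ≤ -x 0 * ((n : ℤ) + 1) := mul_nonneg (by linarith) (by positivity)
    linarith

/-- **(4.3)–(4.4) packaged.**  A level-0 bond function with zero plaquette values and exponential decay `ce^{−γd(e,0)}` is
the coboundary `h(b) − h(a)` of a site function with `|h(x)| ≤ c(1 − e^{−γ/2})⁻¹e^{−(γ/2)|x|}` (in particular `h(x) → 0`).
[cite: Federbush1986PhaseCellI, (4.3)–(4.4) p. 329] -/
theorem exists_gaugeFn {f : Edge 0 → ℝ} {c γ : ℝ} (hγ : 0 < γ) (hf : DecayBound f c γ)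
    (hcurl : ∀ p : Plaq 0, plaqOfBonds f p = 0) :
    ∃ h : (Fin 4 → ℤ) → ℝ, (∀ e : Edge 0, f e = h (e.base + Pi.single e.dir 1) - h e.base) ∧
      ∀ x, |h x| ≤ c * (1 - Real.exp (-(γ / 2)))⁻¹ * Real.exp (-(γ / 2) * ‖(⟨x, 0⟩ : Edge 0).src‖) :=
  ⟨gaugeFn f, fun e => (gaugeFn_bond hγ hf hcurl e.base e.dir).symm, abs_gaugeFn_le hγ hf hcurl⟩

/-- **Uniqueness** («We require h(x) → 0»): a site function with coboundary `f` that tends to `0` along the `+e₀`-rays is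
the gauge function `h`. [cite: Federbush1986PhaseCellI, (4.3) p. 329] -/
theorem gaugeFn_unique {f : Edge 0 → ℝ} {c γ : ℝ} (hγ : 0 < γ) (hf : DecayBound f c γ) {h : (Fin 4 → ℤ) → ℝ}
    (hh : ∀ e : Edge 0, f e = h (e.base + Pi.single e.dir 1) - h e.base)
    (hlim : ∀ x : Fin 4 → ℤ, Tendsto (fun n : ℕ => h (x + Pi.single 0 (n : ℤ))) atTop (nhds 0))
    (x : Fin 4 → ℤ) : h x = gaugeFn f x := by
  have hS := summable_ray hγ hf x 0 fun n => (ray_indices n).1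
  -- partial sums telescope: `Σ_{k<n} f(x + ke₀, 0) = h(x + ne₀) − h(x)`
  have hpart : ∀ n : ℕ,
      ∑ k ∈ Finset.range n, f ⟨x + Pi.single 0 (k : ℤ), 0⟩ = h (x + Pi.single 0 (n : ℤ)) - h x := by
    intro n
    induction n with
    | zero => simp
    | succ n ih =>
        have hh' := hh ⟨x + Pi.single 0 (n : ℤ), 0⟩
        dsimp only at hh'; rw [shift_shift] at hh'
        rw [Finset.sum_range_succ, ih, hh', Nat.cast_succ]; ring
  have h1 : Tendsto (fun n : ℕ => ∑ k ∈ Finset.range n, f ⟨x + Pi.single 0 (k : ℤ), 0⟩) atTop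
      (nhds (∑' n : ℕ, f ⟨x + Pi.single 0 (n : ℤ), 0⟩)) := hS.hasSum.tendsto_sum_nat
  have h2 : Tendsto (fun n : ℕ => ∑ k ∈ Finset.range n, f ⟨x + Pi.single 0 (k : ℤ), 0⟩) atTop
      (nhds (0 - h x)) := by
    simp_rw [hpart]
    exact (hlim x).sub tendsto_const_nhds
  have := tendsto_nhds_unique h1 h2
  unfold gaugeFn; linarith

/-! ## §4 The F1-facing form: data and bond assignments with the same plaquette values -/

/-- Plaquette values are additive in the bond function. [cite: Federbush1986PhaseCellI, (1.4) p. 322] -/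
theorem plaqOfBonds_sub {r : ℕ} (a b : Edge r → ℝ) (p : Plaq r) :
    plaqOfBonds (fun e => a e - b e) p = plaqOfBonds a p - plaqOfBonds b p := by
  unfold plaqOfBonds; ring

/-- **(4.3)–(4.4) for `f = A − A^N`.**  If the level-0 data `a` («A(e), the correct bond assignment») and the bond
assignments `b` of `A^N` («A^N(e)») have THE SAME PLAQUETTE VARIABLES and both decay like `ce^{−γd(e,0)}` ((4.1)–(4.2)),
then `a(e) − b(e) = h(y) − h(x)` for `e = xy` with `|h(x)| ≤ 2c(1 − e^{−γ/2})⁻¹e^{−(γ/2)|x|}`.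
[cite: Federbush1986PhaseCellI, (4.1)–(4.4) p. 329] -/
theorem exists_gaugeFn_of_plaq_eq {a b : Edge 0 → ℝ} (hplaq : ∀ p : Plaq 0, plaqOfBonds a p = plaqOfBonds b p)
    {c γ : ℝ} (hγ : 0 < γ) (ha : DecayBound a c γ) (hb : DecayBound b c γ) :
    ∃ h : (Fin 4 → ℤ) → ℝ, (∀ e : Edge 0, a e - b e = h (e.base + Pi.single e.dir 1) - h e.base) ∧
      ∀ x, |h x| ≤ 2 * c * (1 - Real.exp (-(γ / 2)))⁻¹ * Real.exp (-(γ / 2) * ‖(⟨x, 0⟩ : Edge 0).src‖) := by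
  have hcurl : ∀ p : Plaq 0, plaqOfBonds (fun e => a e - b e) p = 0 := fun p => by
    rw [plaqOfBonds_sub, hplaq p, sub_self]
  have hf : DecayBound (fun e => a e - b e) (2 * c) γ := fun e => by
    have := abs_sub (a e) (b e)
    show |a e - b e| ≤ _
    linarith [ha e, hb e]
  obtain ⟨h, h1, h2⟩ := exists_gaugeFn hγ hf hcurl
  exact ⟨h, h1, h2⟩

end LatticeGauge

end

end Literature.MathematicalPhysics.QuantumFieldTheory.Federbush1986
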